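import Summits.QuantumFields.YangMills.Theorems.SteinGapBootstrapFreeProbeLawGStubSdRateDefect
import Summits.QuantumFields.YangMills.Theorems.SteinGapBootstrapFreeProbeLawGStubFieldBounds
import HarnessLib

/-!
# Crux U `FreeProbeLawG` (stmt-QuantumFields-23756), line `birth`, STUB `stub_sdRate` — part 3: rates and assembly

Route `SteinGapBootstrap` of `QuantumFields/YangMills` (width seat `ym-line-sgb-p1-w2`; the registered stub `stub_sdRate` of the lead's
skeleton `Cruxes/FreeProbeLawG/Lines/birth.lean`, signature verbatim). HONEST LABEL: the route serves the RECORD-label rung R2ξ-G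
(`WeakCouplingRates.XiPow`, an UPPER bound on the lattice gap); nothing here bears on the Yang–Mills mass gap itself.

**The quantitative multi-dimensional single-edge Schwinger–Dyson identity** of torus-limit states for the rescaled comb-gauge
plaquette field `Y = plaqField r β`: for every compact simple `G`, faithful unitary `r` and energy budget `E₀` there are
`Csd ≥ 0`, `c = 6`, `κsd = 1/2` such that for `β ≥ 1`, every `μ ∈ infiniteVolumeLimitPoints r.ρ β` with plaquette energies
`β ∫ (N − Re tr r(U_p)) dμ ≤ E₀`, every link `e`, colour `b`, block `S ⊇ plaquettesTouching {e}` inside the box of radius `ρS`, and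
every `C¹` test `g` of the block field with `|g| ≤ 1`, `‖∇g‖ ≤ M`:

  `|∑_{p∈S} (dδ_e)_p E_μ[∂_{(p,b)} g(Y_S)] − E_μ[g(Y_S) ∑_{p∈S} (dδ_e)_p Y_p^b]| ≤ Csd (1 + M) (1 + ρS)^6 β^(−1/2)`.

Assembly: the defect bound of part 2 (`SdRate.defect_fderiv_le'`, constants maximised over the finitely many colours `b`) at
`θ = 1/√β`, the comb-gauge Poincaré inequality with LINEAR constants of the width seat w3's `FieldBounds.comb_energy_le` (so that the
boundary link energies `W_p` of a plaquette in the `ρS`-box have `∫ W_p dμ ≤ 4·max(E₀,0)(1 + Σ_k|p_k|)²/β`), and the count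
`#S ≤ 16(2ρS + 1)⁴`.

References: S. Chatterjee, arXiv:1602.01222 §§9–11 (axial gauge, Lemma 10.2, Stein heuristics). [arXiv160201222]
-/

set_option autoImplicit false

noncomputable section

open MeasureTheory Filter Topology
open scoped Matrix Matrix.Norms.Frobenius
open Literature.Probability.LatticeModels Literature.MathematicalPhysics.QuantumLattice
open Literature.MathematicalPhysics.QuantumFieldTheory hiding ZdEdge IsLocalObservable IsInfiniteVolumeLimit
open Summit.QuantumFields.YangMills.Theorems.EquipartitionPinsProbe
open Summit.QuantumFields.YangMills.Theorems.EquipartitionPinsProbe.TangentSteinFiniteBeta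

namespace Summit.QuantumFields.YangMills.Cruxes.FreeProbeLawG.SteinFree

namespace SdRate

/-! ### Counting plaquettes in a box -/

/-- A set of plaquettes of `ℤ⁴` whose base points lie in the box of radius `ρS` has at most `16 (2ρS + 1)⁴` elements. -/
theorem card_le_of_box (S : Finset (ZdPlaquette 4)) (ρS : ℕ) (hρS : ∀ p ∈ S, ∀ k : Fin 4, |p.1 k| ≤ (ρS : ℤ)) :
    (S.card : ℝ) ≤ 16 * (2 * (ρS : ℝ) + 1) ^ 4 := by
  classical
  set T : Finset (ZdPlaquette 4) :=
    (Fintype.piFinset fun _ : Fin 4 => Finset.Icc (-(ρS : ℤ)) ρS) ×ˢ (Finset.univ : Finset {p : Fin 4 × Fin 4 // p.1 < p.2})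
    with hT
  have hsub : S ⊆ T := fun p hp => Finset.mem_product.2
    ⟨Fintype.mem_piFinset.2 fun k => Finset.mem_Icc.2 (abs_le.1 (hρS p hp k)), Finset.mem_univ _⟩
  have hIcc : (Finset.Icc (-(ρS : ℤ)) ρS).card = 2 * ρS + 1 := by
    rw [Int.card_Icc]; omega
  have hsubtype : Fintype.card {p : Fin 4 × Fin 4 // p.1 < p.2} ≤ 16 :=
    (Fintype.card_subtype_le _).trans_eq (by simp)
  have hTcard : T.card ≤ (2 * ρS + 1) ^ 4 * 16 := by
    rw [hT, Finset.card_product, Fintype.card_piFinset, Finset.prod_const, Finset.card_univ, Fintype.card_fin, hIcc,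
      Finset.card_univ]
    exact Nat.mul_le_mul_left _ hsubtype
  have h := (Finset.card_le_card hsub).trans hTcard
  calc (S.card : ℝ) ≤ (((2 * ρS + 1) ^ 4 * 16 : ℕ) : ℝ) := by exact_mod_cast h
    _ = 16 * (2 * (ρS : ℝ) + 1) ^ 4 := by push_cast; ring

/-! ### Boundary link energies under a plaquette-energy budget -/

section LinkEnergy

variable {G : Type} [Group G] [TopologicalSpace G] (r : LatticeRep G)

/-- `W_p ≥ 0` for the comb-gauge link energies `W_p(U) = ∑_i (N − Re tr ρ(Ũ_{∂_i p}))` of the boundary of a plaquette. -/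
theorem linkEnergy_nonneg (U : LGConfig 4 G) (p : ZdPlaquette 4) :
    0 ≤ ∑ i : Fin 4, ((r.N : ℝ) - (r.ρ (axialFix U (plaquetteBoundary p i))).trace.re) :=
  Finset.sum_nonneg fun _ _ => sub_nonneg.2 (TangentCombPoincare.re_trace_le r.ρ r.mem_unitary _)

/-- The comb-gauge link energies `W_p` are continuous in the configuration. -/
theorem continuous_linkEnergy [IsTopologicalGroup G] (p : ZdPlaquette 4) : Continuous fun U : LGConfig 4 G =>
    ∑ i : Fin 4, ((r.N : ℝ) - (r.ρ (axialFix U (plaquetteBoundary p i))).trace.re) :=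
  continuous_finsetSum _ fun _ _ => continuous_const.sub
    (Complex.continuous_re.comp ((r.continuous.comp (TangentPlaqFieldContinuous.continuous_axialFix _)).matrix_trace))

end LinkEnergy

section Energies

variable {G : Type} [Group G] [TopologicalSpace G] [IsTopologicalGroup G] [CompactSpace G]
  [MeasurableSpace G] [BorelSpace G] [SecondCountableTopology G] (r : LatticeRep G)

/-- `W_p` is integrable under every finite measure (continuous and bounded on the compact configuration space). -/
theorem integrable_linkEnergy (μ : Measure (LGConfig 4 G)) [IsFiniteMeasure μ] (p : ZdPlaquette 4) :
    Integrable (fun U : LGConfig 4 G => ∑ i : Fin 4, ((r.N : ℝ) - (r.ρ (axialFix U (plaquetteBoundary p i))).trace.re)) μ := by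
  obtain ⟨C, -, hC⟩ := exists_abs_le_of_continuous (continuous_linkEnergy r p)
  exact Integrable.of_bound (continuous_linkEnergy r p).measurable.aestronglyMeasurable C
    (ae_of_all _ fun U => by rw [Real.norm_eq_abs]; exact hC U)

/-- **Boundary link energies under a plaquette-energy budget** (comb Poincaré with LINEAR constants, `FieldBounds.comb_energy_le`):
if `β > 0` and `β ∫ (N − Re tr ρ(U_q)) dμ ≤ E₀` at every plaquette `q` (finite measure `μ`), then
`∫ W_p dμ ≤ 4·max(E₀,0)·(1 + Σ_k|p_k|)²/β`. [cite: arXiv160201222, Lemma 10.2] -/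
theorem integral_linkEnergy_le_poly {β : ℝ} (hβ : 0 < β) (μ : Measure (LGConfig 4 G)) [IsFiniteMeasure μ] {E₀ : ℝ}
    (hE : ∀ (x : Site 4) (i j : Fin 4), i ≠ j → β * (∫ U, ((r.N : ℝ) - plaquetteObs r.ρ x i j U) ∂μ) ≤ E₀)
    (p : ZdPlaquette 4) :
    ∫ U, ∑ i : Fin 4, ((r.N : ℝ) - (r.ρ (axialFix U (plaquetteBoundary p i))).trace.re) ∂μ ≤
      4 * max E₀ 0 * (1 + ∑ k : Fin 4, (|p.1 k| : ℝ)) ^ 2 / β := by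
  set L : ℝ := 1 + ∑ k : Fin 4, (|p.1 k| : ℝ) with hL
  have hL0 : 0 ≤ L := by positivity
  have hEq : ∀ q : ZdPlaquette 4, ∫ U, ((r.N : ℝ) - (r.ρ (plaquetteHolonomyZd U q.1 q.2.1.1 q.2.1.2)).trace.re) ∂μ ≤
      max E₀ 0 / β := by
    intro q
    have h := hE q.1 q.2.1.1 q.2.1.2 (ne_of_lt q.2.2)
    rw [le_div_iff₀ hβ, mul_comm]
    exact h.trans (le_max_left _ _)
  have hEint : ∀ q : ZdPlaquette 4, Integrable (fun U => (r.N : ℝ) - (r.ρ (plaquetteHolonomyZd U q.1 q.2.1.1 q.2.1.2)).trace.re) μ :=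
    fun q => TangentPlaquetteEnergy.integrable_sub_plaquetteObs r.ρ r.continuous r.mem_unitary μ q.1 q.2.1.1 q.2.1.2
  have hdepth : ∀ i : Fin 4, ∃ (n : ℕ) (f : Fin n → ZdPlaquette 4), (n : ℝ) ≤ L ∧ ∀ U : LGConfig 4 G,
      (r.N : ℝ) - (r.ρ (axialFix U (plaquetteBoundary p i))).trace.re ≤
        n * ∑ l, ((r.N : ℝ) - (r.ρ (plaquetteHolonomyZd U (f l).1 (f l).2.1.1 (f l).2.1.2)).trace.re) := by
    intro i
    obtain ⟨f, hf⟩ := FieldBounds.comb_energy_le r.ρ r.mem_unitary (plaquetteBoundary p i).1 (plaquetteBoundary p i).2 rfl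
    exact ⟨_, f, (FieldBounds.depth_le_sum _ _).trans (FieldBounds.sum_abs_boundary_le p i), hf⟩
  choose n f hnL hW using hdepth
  have hint : Integrable (fun U : LGConfig 4 G => ∑ i : Fin 4, ((n i : ℝ) *
      ∑ l, ((r.N : ℝ) - (r.ρ (plaquetteHolonomyZd U (f i l).1 (f i l).2.1.1 (f i l).2.1.2)).trace.re))) μ :=
    integrable_finsetSum _ fun i _ => (integrable_finsetSum _ fun l _ => hEint (f i l)).const_mul _
  calc ∫ U, ∑ i : Fin 4, ((r.N : ℝ) - (r.ρ (axialFix U (plaquetteBoundary p i))).trace.re) ∂μ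
      ≤ ∫ U, ∑ i : Fin 4, ((n i : ℝ) *
          ∑ l, ((r.N : ℝ) - (r.ρ (plaquetteHolonomyZd U (f i l).1 (f i l).2.1.1 (f i l).2.1.2)).trace.re)) ∂μ :=
        integral_mono (integrable_linkEnergy r μ p) hint fun U => Finset.sum_le_sum fun i _ => hW i U
    _ = ∑ i : Fin 4, ((n i : ℝ) *
          ∑ l, ∫ U, ((r.N : ℝ) - (r.ρ (plaquetteHolonomyZd U (f i l).1 (f i l).2.1.1 (f i l).2.1.2)).trace.re) ∂μ) := by
        rw [integral_finsetSum _ fun i _ => (integrable_finsetSum _ fun l _ => hEint (f i l)).const_mul _]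
        refine Finset.sum_congr rfl fun i _ => ?_
        rw [integral_const_mul, integral_finsetSum _ fun l _ => hEint (f i l)]
    _ ≤ ∑ i : Fin 4, ((n i : ℝ) * ∑ _l : Fin (n i), max E₀ 0 / β) :=
        Finset.sum_le_sum fun i _ => mul_le_mul_of_nonneg_left (Finset.sum_le_sum fun l _ => hEq _) (Nat.cast_nonneg _)
    _ = max E₀ 0 / β * ∑ i : Fin 4, ((n i : ℝ) * (n i : ℝ)) := by
        simp only [Finset.sum_const, Finset.card_univ, Fintype.card_fin, nsmul_eq_mul]
        rw [Finset.mul_sum]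
        exact Finset.sum_congr rfl fun i _ => by ring
    _ ≤ max E₀ 0 / β * ∑ _i : Fin 4, L * L := by
        refine mul_le_mul_of_nonneg_left (Finset.sum_le_sum fun i _ => ?_) (by positivity)
        exact mul_le_mul (hnL i) (hnL i) (Nat.cast_nonneg _) hL0
    _ = 4 * max E₀ 0 * (1 + ∑ k : Fin 4, (|p.1 k| : ℝ)) ^ 2 / β := by
        simp only [Finset.sum_const, Finset.card_univ, Fintype.card_fin, nsmul_eq_mul, hL]
        field_simp
        ring

/-- The polynomial budget of the boundary link energies summed over a block in the `ρS`-box: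
`∑_{p∈S} ∫ W_p dμ ≤ 16384 · max(E₀,0) · (1 + ρS)⁶ / β`. -/
theorem sum_integral_linkEnergy_le {β : ℝ} (hβ : 0 < β) (μ : Measure (LGConfig 4 G)) [IsFiniteMeasure μ] {E₀ : ℝ}
    (hE : ∀ (x : Site 4) (i j : Fin 4), i ≠ j → β * (∫ U, ((r.N : ℝ) - plaquetteObs r.ρ x i j U) ∂μ) ≤ E₀)
    (S : Finset (ZdPlaquette 4)) (ρS : ℕ) (hρS : ∀ p ∈ S, ∀ k : Fin 4, |p.1 k| ≤ (ρS : ℤ)) :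
    ∑ p ∈ S, ∫ U, ∑ i : Fin 4, ((r.N : ℝ) - (r.ρ (axialFix U (plaquetteBoundary p i))).trace.re) ∂μ ≤
      16384 * max E₀ 0 * (1 + (ρS : ℝ)) ^ 6 / β := by
  have hρ0 : (0 : ℝ) ≤ ρS := Nat.cast_nonneg _
  have hE0 : 0 ≤ max E₀ 0 := le_max_right _ _
  have hterm : ∀ p ∈ S, ∫ U, ∑ i : Fin 4, ((r.N : ℝ) - (r.ρ (axialFix U (plaquetteBoundary p i))).trace.re) ∂μ ≤
      4 * max E₀ 0 * (1 + 4 * (ρS : ℝ)) ^ 2 / β := by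
    intro p hp
    refine (integral_linkEnergy_le_poly r hβ μ hE p).trans ?_
    have hsum : ∑ k : Fin 4, (|p.1 k| : ℝ) ≤ 4 * (ρS : ℝ) := by
      have h : ∀ k : Fin 4, (|p.1 k| : ℝ) ≤ (ρS : ℝ) := fun k => by exact_mod_cast hρS p hp k
      calc ∑ k : Fin 4, (|p.1 k| : ℝ) ≤ ∑ _k : Fin 4, (ρS : ℝ) := Finset.sum_le_sum fun k _ => h k
        _ = 4 * (ρS : ℝ) := by simp
    have hL0 : 0 ≤ 1 + ∑ k : Fin 4, (|p.1 k| : ℝ) := by positivity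
    exact div_le_div_of_nonneg_right (mul_le_mul_of_nonneg_left
      (pow_le_pow_left₀ hL0 (by linarith) 2) (by positivity)) hβ.le
  calc ∑ p ∈ S, ∫ U, ∑ i : Fin 4, ((r.N : ℝ) - (r.ρ (axialFix U (plaquetteBoundary p i))).trace.re) ∂μ
      ≤ ∑ p ∈ S, 4 * max E₀ 0 * (1 + 4 * (ρS : ℝ)) ^ 2 / β := Finset.sum_le_sum hterm
    _ = S.card * (4 * max E₀ 0 * (1 + 4 * (ρS : ℝ)) ^ 2 / β) := by rw [Finset.sum_const, nsmul_eq_mul]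
    _ ≤ 16 * (2 * (ρS : ℝ) + 1) ^ 4 * (4 * max E₀ 0 * (1 + 4 * (ρS : ℝ)) ^ 2 / β) :=
        mul_le_mul_of_nonneg_right (card_le_of_box S ρS hρS) (by positivity)
    _ ≤ 16384 * max E₀ 0 * (1 + (ρS : ℝ)) ^ 6 / β := by
        have h1 : (2 * (ρS : ℝ) + 1) ^ 4 ≤ 16 * (1 + (ρS : ℝ)) ^ 4 := by
          calc (2 * (ρS : ℝ) + 1) ^ 4 ≤ (2 * (1 + (ρS : ℝ))) ^ 4 := pow_le_pow_left₀ (by positivity) (by linarith) 4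
            _ = 16 * (1 + (ρS : ℝ)) ^ 4 := by ring
        have h2 : (1 + 4 * (ρS : ℝ)) ^ 2 ≤ 16 * (1 + (ρS : ℝ)) ^ 2 := by
          calc (1 + 4 * (ρS : ℝ)) ^ 2 ≤ (4 * (1 + (ρS : ℝ))) ^ 2 := pow_le_pow_left₀ (by positivity) (by linarith) 2
            _ = 16 * (1 + (ρS : ℝ)) ^ 2 := by ring
        have h3 : (2 * (ρS : ℝ) + 1) ^ 4 * (1 + 4 * (ρS : ℝ)) ^ 2 ≤ (16 * (1 + (ρS : ℝ)) ^ 4) * (16 * (1 + (ρS : ℝ)) ^ 2) :=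
          mul_le_mul h1 h2 (by positivity) (by positivity)
        have h4 := mul_le_mul_of_nonneg_left h3 (show 0 ≤ 64 * max E₀ 0 / β by positivity)
        calc 16 * (2 * (ρS : ℝ) + 1) ^ 4 * (4 * max E₀ 0 * (1 + 4 * (ρS : ℝ)) ^ 2 / β)
            = 64 * max E₀ 0 / β * ((2 * (ρS : ℝ) + 1) ^ 4 * (1 + 4 * (ρS : ℝ)) ^ 2) := by ring
          _ ≤ 64 * max E₀ 0 / β * ((16 * (1 + (ρS : ℝ)) ^ 4) * (16 * (1 + (ρS : ℝ)) ^ 2)) := h4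
          _ = 16384 * max E₀ 0 * (1 + (ρS : ℝ)) ^ 6 / β := by ring

end Energies

end SdRate

open SdRate

/-- STUB `stub_sdRate` of line `birth` (crux U `FreeProbeLawG`, stmt-QuantumFields-23756) — **the quantitative multi-dimensional
single-edge Schwinger–Dyson identity** of torus-limit states for the rescaled comb-gauge plaquette field:
`E_μ[∂_v g(Y_S)] ≈ E_μ[g(Y_S)·Σ_p (dδ_e)_p Y_p^b]`, `v_(p,a) = (dδ_e)_p [a = b]`, with error `Csd (1+M)(1+ρS)^6 β^(−1/2)` for bounded
`C¹` tests `g` with `‖∇g‖ ≤ M`, supports `S ⊇ plaquettesTouching {e}` of radius `ρS`, plaquette energies `≤ E₀/β` (`c = 6`,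
`κsd = 1/2`). HONEST LABEL: an input of the RECORD-label rung R2ξ-G; not a statement about the Yang–Mills mass gap. -/
theorem stub_sdRate :
    ∀ (G : Type) [Group G] [TopologicalSpace G] [IsTopologicalGroup G] [CompactSpace G]
      [MeasurableSpace G] [BorelSpace G],
      Literature.MathematicalPhysics.QuantumFieldTheory.IsCompactSimpleLieGroup G →
      ∀ r : Literature.MathematicalPhysics.QuantumFieldTheory.LatticeRep G,
        ∀ E₀ : ℝ, ∃ Csd c κsd : ℝ, 0 < κsd ∧ 0 ≤ Csd ∧ ∀ β : ℝ, 1 ≤ β →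
          ∀ μ ∈ Literature.MathematicalPhysics.QuantumLattice.infiniteVolumeLimitPoints (d := 4) r.ρ β,
            (∀ (x : Literature.Probability.LatticeModels.Site 4) (i j : Fin 4), i ≠ j →
              β * (∫ U, ((r.N : ℝ) - Literature.MathematicalPhysics.QuantumLattice.plaquetteObs r.ρ x i j U) ∂μ) ≤ E₀) →
            ∀ (e : Literature.MathematicalPhysics.QuantumLattice.ZdEdge 4) (b : Fin (Summit.QuantumFields.YangMills.Theorems.EquipartitionPinsProbe.lieDim r)) (S : Finset (Literature.MathematicalPhysics.QuantumLattice.ZdPlaquette 4)) (ρS : ℕ),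
              Literature.MathematicalPhysics.QuantumLattice.plaquettesTouching {e} ⊆ S → (∀ p ∈ S, ∀ k : Fin 4, |p.1 k| ≤ (ρS : ℤ)) →
              ∀ (g : (↥S → Fin (Summit.QuantumFields.YangMills.Theorems.EquipartitionPinsProbe.lieDim r) → ℝ) → ℝ) (M : ℝ), 0 ≤ M → ContDiff ℝ 1 g →
                (∀ y, |g y| ≤ 1) → (∀ y, ‖fderiv ℝ g y‖ ≤ M) →
                |(∑ p : ↥S, Literature.MathematicalPhysics.QuantumFieldTheory.plaquetteCurl (fun e' => if e' = e then (1 : ℝ) else 0) (p : Literature.MathematicalPhysics.QuantumLattice.ZdPlaquette 4) *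
                      ∫ U, fderiv ℝ g (fun q a => Summit.QuantumFields.YangMills.Theorems.EquipartitionPinsProbe.plaqField r β U (q : Literature.MathematicalPhysics.QuantumLattice.ZdPlaquette 4) a)
                        (fun q a => if q = p ∧ a = b then (1 : ℝ) else 0) ∂μ) -
                    ∫ U, g (fun q a => Summit.QuantumFields.YangMills.Theorems.EquipartitionPinsProbe.plaqField r β U (q : Literature.MathematicalPhysics.QuantumLattice.ZdPlaquette 4) a) *
                      (∑ p ∈ S, Literature.MathematicalPhysics.QuantumFieldTheory.plaquetteCurl (fun e' => if e' = e then (1 : ℝ) else 0) p *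
                        Summit.QuantumFields.YangMills.Theorems.EquipartitionPinsProbe.plaqField r β U p b) ∂μ| ≤
                  Csd * (1 + M) * (1 + (ρS : ℝ)) ^ c * β ^ (-κsd) := by
  intro G _ _ _ _ _ _ hG r E₀
  haveI : SecondCountableTopology G :=
    (r.continuous.isClosedEmbedding r.injective).isEmbedding.secondCountableTopology
  haveI : T2Space G := (r.continuous.isClosedEmbedding r.injective).isEmbedding.t2Space
  -- per-colour constants (part 2), dominated by their sum over the finitely many colours
  have hcol : ∀ b : Fin (lieDim r), ∃ K : ℝ, 0 ≤ K ∧ ∀ {β : ℝ}, 0 < β → ∀ (μ : Measure (LGConfig 4 G)),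
      μ ∈ infiniteVolumeLimitPoints (d := 4) r.ρ β →
      ∀ (e : Literature.MathematicalPhysics.QuantumLattice.ZdEdge 4) (S : Finset (ZdPlaquette 4)),
        plaquettesTouching ({e} : Finset (Literature.MathematicalPhysics.QuantumLattice.ZdEdge 4)) ⊆ S →
        ∀ (g : (↥S → Fin (lieDim r) → ℝ) → ℝ) {M : ℝ}, 0 ≤ M → ContDiff ℝ 1 g →
          (∀ y, |g y| ≤ 1) → (∀ y, ‖fderiv ℝ g y‖ ≤ M) → ∀ {θ : ℝ}, 0 < θ →
    |(∑ p : ↥S, plaquetteCurl (fun e' => if e' = e then (1 : ℝ) else 0) (p : ZdPlaquette 4) *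
          ∫ U, fderiv ℝ g (fun q a => plaqField r β U (q : ZdPlaquette 4) a)
            (fun q a => if q = p ∧ a = b then (1 : ℝ) else 0) ∂μ) -
        ∫ U, g (fun q a => plaqField r β U (q : ZdPlaquette 4) a) *
          (∑ p ∈ S, plaquetteCurl (fun e' => if e' = e then (1 : ℝ) else 0) p * plaqField r β U p b) ∂μ| ≤
      M * (θ / 2 + K * (∫ U, ∑ p ∈ S, ∑ i : Fin 4,
          ((r.N : ℝ) - (r.ρ (axialFix U (plaquetteBoundary p i))).trace.re) ∂μ) / (2 * θ)) +
        K * Real.sqrt β * ∫ U, ∑ q ∈ plaquettesTouching ({e} : Finset (Literature.MathematicalPhysics.QuantumLattice.ZdEdge 4)),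
          ∑ i : Fin 4, ((r.N : ℝ) - (r.ρ (axialFix U (plaquetteBoundary q i))).trace.re) ∂μ := fun b => by
    obtain ⟨k, hk⟩ := exists_oneParam r b
    exact defect_fderiv_le' r b hk
  choose Kb hKb0 hKb using hcol
  set K : ℝ := ∑ b, Kb b with hKdef
  have hKle : ∀ b, Kb b ≤ K := fun b =>
    Finset.single_le_sum (f := fun b => Kb b) (fun b _ => hKb0 b) (Finset.mem_univ b)
  have hK0 : 0 ≤ K := Finset.sum_nonneg fun b _ => hKb0 b
  set B₀ : ℝ := 16384 * max E₀ 0 with hB₀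
  have hB₀0 : 0 ≤ B₀ := by positivity
  refine ⟨1 / 2 + K * B₀, 6, 1 / 2, by norm_num, by positivity, ?_⟩
  intro β hβ μ hμ hE e b S ρS hS hρS g M hM hg hgb hgM
  have hβ0 : 0 < β := by linarith
  haveI : IsProbabilityMeasure μ := by
    obtain ⟨L, -, hP, -⟩ := hμ
    exact hP
  set s : ℝ := Real.sqrt β with hsdef
  have hs0 : 0 < s := Real.sqrt_pos.2 hβ0
  have hs2 : s ^ 2 = β := Real.sq_sqrt hβ0.le
  set P : ℝ := (1 + (ρS : ℝ)) ^ 6 with hP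
  have hP1 : 1 ≤ P := one_le_pow₀ (by simp)
  -- the defect bound of part 2 at `θ = 1/s`
  have hθ : 0 < 1 / s := by positivity
  have hdef := hKb b hβ0 μ hμ e S hS g hM hg hgb hgM hθ
  -- the two energy integrals
  have hWS : ∫ U, ∑ p ∈ S, ∑ i : Fin 4, ((r.N : ℝ) - (r.ρ (axialFix U (plaquetteBoundary p i))).trace.re) ∂μ ≤
      B₀ * P / s ^ 2 := by
    rw [hs2, integral_finsetSum _ fun p _ => integrable_linkEnergy r μ p]
    exact sum_integral_linkEnergy_le r hβ0 μ hE S ρS hρS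
  have hWPe : ∫ U, ∑ q ∈ plaquettesTouching ({e} : Finset (Literature.MathematicalPhysics.QuantumLattice.ZdEdge 4)),
      ∑ i : Fin 4, ((r.N : ℝ) - (r.ρ (axialFix U (plaquetteBoundary q i))).trace.re) ∂μ ≤ B₀ * P / s ^ 2 := by
    rw [hs2, integral_finsetSum _ fun q _ => integrable_linkEnergy r μ q]
    refine (Finset.sum_le_sum_of_subset_of_nonneg hS fun p _ _ =>
      integral_nonneg fun U => linkEnergy_nonneg r U p).trans ?_
    exact sum_integral_linkEnergy_le r hβ0 μ hE S ρS hρS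
  -- algebra
  have halg : M * ((1 / s) / 2 + Kb b * (B₀ * P / s ^ 2) / (2 * (1 / s))) + Kb b * s * (B₀ * P / s ^ 2) =
      (M / 2 + M * Kb b * B₀ * P / 2 + Kb b * B₀ * P) / s := by
    field_simp
  have hmono : M * ((1 / s) / 2 + Kb b * (∫ U, ∑ p ∈ S, ∑ i : Fin 4,
        ((r.N : ℝ) - (r.ρ (axialFix U (plaquetteBoundary p i))).trace.re) ∂μ) / (2 * (1 / s))) +
      Kb b * Real.sqrt β * ∫ U, ∑ q ∈ plaquettesTouching ({e} : Finset (Literature.MathematicalPhysics.QuantumLattice.ZdEdge 4)),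
        ∑ i : Fin 4, ((r.N : ℝ) - (r.ρ (axialFix U (plaquetteBoundary q i))).trace.re) ∂μ ≤
      M * ((1 / s) / 2 + Kb b * (B₀ * P / s ^ 2) / (2 * (1 / s))) + Kb b * s * (B₀ * P / s ^ 2) := by
    refine add_le_add (mul_le_mul_of_nonneg_left (add_le_add le_rfl
      (div_le_div_of_nonneg_right (mul_le_mul_of_nonneg_left hWS (hKb0 b)) (by positivity))) hM) ?_
    rw [← hsdef]
    exact mul_le_mul_of_nonneg_left hWPe (mul_nonneg (hKb0 b) hs0.le)
  have hnum : M / 2 + M * Kb b * B₀ * P / 2 + Kb b * B₀ * P ≤ (1 / 2 + K * B₀) * (1 + M) * P := by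
    have h1 : M / 2 ≤ (1 + M) * P / 2 := by nlinarith
    have h2 : M * Kb b * B₀ * P / 2 ≤ M * K * B₀ * P := by
      have : M * Kb b * B₀ * P ≤ M * K * B₀ * P :=
        mul_le_mul_of_nonneg_right (mul_le_mul_of_nonneg_right (mul_le_mul_of_nonneg_left (hKle b) hM) hB₀0) (by positivity)
      have h0 : 0 ≤ M * Kb b * B₀ * P := by have := hKb0 b; positivity
      linarith
    have h3 : Kb b * B₀ * P ≤ K * B₀ * P :=
      mul_le_mul_of_nonneg_right (mul_le_mul_of_nonneg_right (hKle b) hB₀0) (by positivity)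
    nlinarith
  have hrhs : (1 / 2 + K * B₀) * (1 + M) * (1 + (ρS : ℝ)) ^ (6 : ℝ) * β ^ (-(1 / 2 : ℝ)) =
      (1 / 2 + K * B₀) * (1 + M) * P / s := by
    rw [show (6 : ℝ) = ((6 : ℕ) : ℝ) by norm_num, Real.rpow_natCast, Real.rpow_neg hβ0.le, ← Real.sqrt_eq_rpow, ← hP, ← hsdef]
    ring
  rw [hrhs]
  refine hdef.trans (hmono.trans ?_)
  rw [halg]
  exact div_le_div_of_nonneg_right hnum hs0.le

end Summit.QuantumFields.YangMills.Cruxes.FreeProbeLawG.SteinFree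

end
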